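import Summits.KontsevichZagierPeriods.KontsevichZagierPeriods.Theses.TerasomaMultiplication
import Summits.KontsevichZagierPeriods.KontsevichZagierPeriods.Theorems.GammaHodgeSector.Negative.LoadBearing
import Literature.NumberTheory.Transcendental.KZKernelConjectureForms
import Literature.NumberTheory.Transcendental.KZCalculusProofs
import Literature.Barriers.KontsevichZagierPeriods.PeriodEqualityDecidability

/-!
# `CompleteModGammaSector` (stmt-KontsevichZagierPeriods-14233; successor of the retired sup/closure
form `GammaSectorComplete`, stmt-10378) — negative side I: subgroup form ⇔ sector form; the crux is
the summit relative to the Γ-sector; kernel form; load-bearing analysis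

Landed copy of §0–§3 of the crux work file `Cruxes/GammaSectorComplete/Disproof.lean`
(standing adversary `cdisprove`, gen 1):

* `gammaHodgePairs`, `sector := relations ⊔ closure gammaHodgePairs`, `SectorForm` (the retired
  stmt-10378 verbatim) and `completeModGammaSector_iff_sectorForm` (the live subgroup form is
  equivalent: `sector` is the least admissible `H`);
* `of_summit : KontsevichZagierPeriods → CompleteModGammaSector`, `summit_false_of_not`,
  `gammaHodgeSector_iff_closure_le : GammaHodgeSector ↔ closure gammaHodgePairs ≤ relations`,
  `iff_summit_of_gammaHodgeSector` — a kill of the crux is a kill of the summit as formalised;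
* `sector_le_ker_eval` (no evaluation kill) and the KERNEL FORM
  `completeModGammaSector_iff_ker_le : CompleteModGammaSector ↔ ker eval ≤ sector`;
* `completeModGammaSector_false_without_valueEq` (value equality is load-bearing: `[pt,1] ≁ [pt,2]`)
  and `completeModGammaSector_iff_withoutRational` (the rational shape is not).
-/

noncomputable section

open MeasureTheory Set
open scoped BigOperators

namespace Summit.KontsevichZagierPeriods.CompleteModGammaSectorNegative

open Literature.NumberTheory.Transcendental
open Literature.NumberTheory.Transcendental.KZ
open Summit.KontsevichZagierPeriods.KontsevichZagierPeriods.Theses.TerasomaMultiplication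
  (CompleteModGammaSector GammaHodgeSector closes)
open Summit.KontsevichZagierPeriods.GammaHodgeSectorNegative
open Literature.Barriers.KontsevichZagierPeriods.KZ (constRep constRep_value constRep_isRational)

/-! ## §0 Vocabulary: the Γ-Hodge pairs and the sector subgroup -/

/-- The generating set of the Γ-sector: the formal differences `[ρ] − [ρ']` of cube Beta
representation and `2k`-ball × cube representation under the Deligne–Koblitz–Ogus hypotheses —
VERBATIM the set inside the retired `GammaSectorComplete` and inside the pair hypothesis of the live
`CompleteModGammaSector`.
[cite: Deligne1982HodgeCycles, Thm. 7.18] -/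
def gammaHodgePairs : Set FormalRep :=
  {d : FormalRep | ∃ (N N' k : ℕ) (x y : Fin N → ℚ) (x' y' : Fin N' → ℚ) (c : ℝ)
      (ρ : IntegralRep N) (ρ' : IntegralRep (2 * k + N')),
    (∀ j, 0 < x j ∧ 0 < y j ∧ Int.fract (x j) ≠ 0 ∧ Int.fract (y j) ≠ 0) ∧
    (∀ l, 0 < x' l ∧ 0 < y' l ∧ Int.fract (x' l) ≠ 0 ∧ Int.fract (y' l) ≠ 0) ∧
    (∀ u : ℕ, 0 < u → (∀ j, Nat.Coprime u (x j).den ∧ Nat.Coprime u (y j).den) →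
      (∀ l, Nat.Coprime u (x' l).den ∧ Nat.Coprime u (y' l).den) →
      ((∑ j, (Int.fract ((u : ℚ) * x j) + Int.fract ((u : ℚ) * y j) -
          Int.fract ((u : ℚ) * (x j + y j)))) -
        ∑ l, (Int.fract ((u : ℚ) * x' l) + Int.fract ((u : ℚ) * y' l) -
          Int.fract ((u : ℚ) * (x' l + y' l)))) = (k : ℚ)) ∧
    IsAlgebraic ℚ c ∧
    ρ.domain = {t | ∀ j, t j ∈ Set.Ioo (0:ℝ) 1} ∧
    Set.EqOn ρ.integrand (fun t => ∏ j, (t j) ^ ((x j : ℝ) - 1) * (1 - t j) ^ ((y j : ℝ) - 1))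
      ρ.domain ∧
    ρ'.domain = {z | (∑ i : Fin (2 * k), (z (Fin.castAdd N' i)) ^ 2) < 1 ∧
      ∀ l : Fin N', z (Fin.natAdd (2 * k) l) ∈ Set.Ioo (0:ℝ) 1} ∧
    Set.EqOn ρ'.integrand (fun z => c * (k.factorial : ℝ) *
      ∏ l, (z (Fin.natAdd (2 * k) l)) ^ ((x' l : ℝ) - 1) *
        (1 - z (Fin.natAdd (2 * k) l)) ^ ((y' l : ℝ) - 1)) ρ'.domain ∧
    ρ.value = ρ'.value ∧ d = of ρ - of ρ'}

/-- The Γ-sector subgroup: the moves together with the Γ-Hodge pairs taken as extra axioms.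
[cite: KontsevichZagier2001, §1.2] -/
def sector : AddSubgroup FormalRep := relations ⊔ AddSubgroup.closure gammaHodgePairs

/-- **The working form** (the retired statement of stmt-KontsevichZagierPeriods-10378,
`GammaSectorComplete`, verbatim up to the name `sector`): Conjecture 1 in the rational
two-representation form with `relations` replaced by `sector`. -/
def SectorForm : Prop :=
  ∀ ⦃n m : ℕ⦄ (r : IntegralRep n) (r' : IntegralRep m),
    r.IsRational → r'.IsRational → r.value = r'.value → of r - of r' ∈ sector

/-- Membership in `gammaHodgePairs` in the structured vocabulary of the sibling crux
(`Admissible`, `HodgeCondition`, `IsCubeBetaRep`, `IsBallCubeRep`). [folklore] -/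
theorem mem_gammaHodgePairs_iff {d : FormalRep} :
    d ∈ gammaHodgePairs ↔
      ∃ (N N' k : ℕ) (x y : Fin N → ℚ) (x' y' : Fin N' → ℚ) (c : ℝ) (ρ : IntegralRep N)
        (ρ' : IntegralRep (2 * k + N')),
        Admissible x y ∧ Admissible x' y' ∧ HodgeCondition N N' k x y x' y' ∧ IsAlgebraic ℚ c ∧
        IsCubeBetaRep x y ρ ∧ IsBallCubeRep k x' y' c ρ' ∧ ρ.value = ρ'.value ∧
        d = of ρ - of ρ' := by
  constructor
  · rintro ⟨N, N', k, x, y, x', y', c, ρ, ρ', hx, hx', hH, hc, hd, hi, hd', hi', hv, rfl⟩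
    exact ⟨N, N', k, x, y, x', y', c, ρ, ρ', hx, hx', hH, hc, ⟨hd, hi⟩, ⟨hd', hi'⟩, hv, rfl⟩
  · rintro ⟨N, N', k, x, y, x', y', c, ρ, ρ', hx, hx', hH, hc, ⟨hd, hi⟩, ⟨hd', hi'⟩, hv, rfl⟩
    exact ⟨N, N', k, x, y, x', y', c, ρ, ρ', hx, hx', hH, hc, hd, hi, hd', hi', hv, rfl⟩

/-- A Γ-Hodge pair difference lies in the sector. [folklore] -/
theorem of_sub_of_mem_sector_of_pair {N N' k : ℕ} {x y : Fin N → ℚ} {x' y' : Fin N' → ℚ} {c : ℝ}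
    {ρ : IntegralRep N} {ρ' : IntegralRep (2 * k + N')}
    (hx : Admissible x y) (hx' : Admissible x' y') (hH : HodgeCondition N N' k x y x' y')
    (hc : IsAlgebraic ℚ c) (hρ : IsCubeBetaRep x y ρ) (hρ' : IsBallCubeRep k x' y' c ρ')
    (hv : ρ.value = ρ'.value) : of ρ - of ρ' ∈ sector :=
  AddSubgroup.mem_sup_right (AddSubgroup.subset_closure
    (mem_gammaHodgePairs_iff.mpr ⟨N, N', k, x, y, x', y', c, ρ, ρ', hx, hx', hH, hc, hρ, hρ', hv, rfl⟩))

/-- **The live crux is the working form**: `CompleteModGammaSector` (stmt-14233, the SUBGROUP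
form: every additive subgroup `H ≥ relations` containing all Γ-Hodge pair differences contains all
rational equal-value differences) `↔ SectorForm` (the sup/closure form of the retired stmt-10378):
`sector` is the least such `H`. [folklore] -/
theorem completeModGammaSector_iff_sectorForm : CompleteModGammaSector ↔ SectorForm := by
  constructor
  · intro h n m r r' hr hr' hv
    refine h sector le_sup_left ?_ r r' hr hr' hv
    intro N N' k x y x' y' c hx hx' hH hc ρ ρ' hd hi hd' hi' hval
    exact of_sub_of_mem_sector_of_pair hx hx' hH hc ⟨hd, hi⟩ ⟨hd', hi'⟩ hval
  · intro h H hrel hpairs n m r r' hr hr' hv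
    have hle : sector ≤ H := by
      refine sup_le hrel ((AddSubgroup.closure_le _).mpr ?_)
      rintro d ⟨N, N', k, x, y, x', y', c, ρ, ρ', hx, hx', hH, hc, hd, hi, hd', hi', hval, rfl⟩
      exact hpairs N N' k x y x' y' c hx hx' hH hc ρ ρ' hd hi hd' hi' hval
    exact hle (h r r' hr hr' hv)

/-! ## §1 Structure: the crux is the summit relative to the Γ-sector -/

/-- **The summit implies the crux** (`relations ≤ sector`). Hence every refutation of the crux is
a refutation of Conjecture 1 as formalised. [cite: KontsevichZagier2001, §1.2 Conjecture 1] -/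
theorem sectorForm_of_summit (h : KontsevichZagierPeriods) : SectorForm :=
  fun _ _ r r' hr hr' hv => AddSubgroup.mem_sup_left (h r r' hr hr' hv)

/-- **The summit implies the live crux** `CompleteModGammaSector`. [cite: KontsevichZagier2001, §1.2 Conjecture 1] -/
theorem of_summit (h : KontsevichZagierPeriods) : CompleteModGammaSector :=
  completeModGammaSector_iff_sectorForm.mpr (sectorForm_of_summit h)

/-- Contrapositive of `of_summit`: a refutation of the crux refutes the summit as formalised.
[folklore] -/
theorem summit_false_of_not (h : ¬ CompleteModGammaSector) : ¬ KontsevichZagierPeriods :=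
  fun hs => h (of_summit hs)

/-- The sibling crux `GammaHodgeSector` says exactly that the Γ-Hodge pairs are already relations:
`GammaHodgeSector ↔ closure gammaHodgePairs ≤ relations`. [folklore] -/
theorem gammaHodgeSector_iff_closure_le :
    GammaHodgeSector ↔ AddSubgroup.closure gammaHodgePairs ≤ relations := by
  constructor
  · intro h
    refine (AddSubgroup.closure_le _).mpr ?_
    intro d hd
    obtain ⟨N, N', k, x, y, x', y', c, ρ, ρ', hx, hx', hH, hc, hρ, hρ', hv, rfl⟩ :=
      mem_gammaHodgePairs_iff.mp hd
    exact h N N' k x y x' y' c hx hx' hH hc ρ ρ' hρ.1 hρ.2 hρ'.1 hρ'.2 hv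
  · intro h N N' k x y x' y' c hx hx' hH hc ρ ρ' hd hi hd' hi' hv
    exact h (AddSubgroup.subset_closure
      (mem_gammaHodgePairs_iff.mpr ⟨N, N', k, x, y, x', y', c, ρ, ρ', hx, hx', hH, hc, ⟨hd, hi⟩, ⟨hd', hi'⟩, hv, rfl⟩))

/-- Under the sibling crux the sector collapses to the moves. [folklore] -/
theorem sector_eq_relations_of_gammaHodgeSector (h : GammaHodgeSector) : sector = relations :=
  le_antisymm (sup_le le_rfl (gammaHodgeSector_iff_closure_le.mp h)) le_sup_left

/-- **Given the Γ-sector, the crux IS the summit** (the route's deciding theorem `closes`, read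
both ways). [folklore] -/
theorem iff_summit_of_gammaHodgeSector (hΓ : GammaHodgeSector) :
    CompleteModGammaSector ↔ KontsevichZagierPeriods :=
  ⟨fun h => closes hΓ h, of_summit⟩

/-! ## §2 Kernel form: `sector ≤ ker eval`, and the crux says `ker eval ≤ sector` -/

/-- Every Γ-Hodge pair evaluates to `0` (its value conjunct). [folklore] -/
theorem closure_gammaHodgePairs_le_ker_eval : AddSubgroup.closure gammaHodgePairs ≤ eval.ker := by
  refine (AddSubgroup.closure_le _).mpr ?_
  intro d hd
  obtain ⟨N, N', k, x, y, x', y', c, ρ, ρ', -, -, -, -, -, -, hv, rfl⟩ := mem_gammaHodgePairs_iff.mp hd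
  show eval (of ρ - of ρ') = 0
  rw [eval_of_sub_of, hv, sub_self]

/-- **No evaluation kill**: the whole sector lies in the kernel of evaluation (soundness of the
moves, `KZ.relations_le_ker_eval_holds`, plus the previous lemma). [cite: KontsevichZagier2001, §1.2] -/
theorem sector_le_ker_eval : sector ≤ eval.ker :=
  sup_le relations_le_ker_eval_holds closure_gammaHodgePairs_le_ker_eval

/-- Elements of the sector evaluate to `0`. [folklore] -/
theorem eval_eq_zero_of_mem_sector {c : FormalRep} (hc : c ∈ sector) : eval c = 0 :=
  sector_le_ker_eval hc

/-- **Kernel form of the crux**: `SectorForm ↔ ker eval ≤ sector` (so, with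
`sector_le_ker_eval`, the crux says `ker eval = sector`). A refutation is therefore exactly an
element of `ker eval ∖ sector` — an additive invariant of `FormalRep` killing the four move sets
and the Γ-Hodge pairs and not factoring through `eval`.
[cite: KontsevichZagier2001, §1.2 Conjecture 1] [cite: HuberMullerStachPeriods2017, Conj. 13.2.1] -/
theorem sectorForm_iff_ker_le : SectorForm ↔ eval.ker ≤ sector := by
  constructor
  · intro h c hc
    have hc0 : eval c = 0 := hc
    obtain ⟨n, m, r, r', hrel⟩ := exists_integralRep_sub_holds c
    obtain ⟨N, R, hR, hrR⟩ := exists_isRational_equivalent_holds r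
    obtain ⟨N', R', hR', hrR'⟩ := exists_isRational_equivalent_holds r'
    have hker : eval (c - (of r - of r')) = 0 := relations_le_ker_eval_holds hrel
    rw [map_sub, hc0, zero_sub, neg_eq_zero, eval_of_sub_of, sub_eq_zero] at hker
    have hv : R.value = R'.value := by
      rw [← Equivalent.value_eq_holds hrR, ← Equivalent.value_eq_holds hrR', hker]
    have hRR' : of R - of R' ∈ sector := h R R' hR hR' hv
    have h1 : of r - of R ∈ sector := AddSubgroup.mem_sup_left hrR
    have h2 : of R' - of r' ∈ sector := AddSubgroup.mem_sup_left hrR'.symm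
    have h3 : c - (of r - of r') ∈ sector := AddSubgroup.mem_sup_left hrel
    have hc' : c = (c - (of r - of r')) + ((of r - of R) + (of R - of R') + (of R' - of r')) := by
      abel
    rw [hc']
    exact sector.add_mem h3 (sector.add_mem (sector.add_mem h1 hRR') h2)
  · intro h n m r r' _ _ hv
    apply h
    show eval (of r - of r') = 0
    rw [eval_of_sub_of, hv, sub_self]

/-- Kernel form of the live crux: `CompleteModGammaSector ↔ ker eval ≤ sector`. [folklore] -/
theorem completeModGammaSector_iff_ker_le : CompleteModGammaSector ↔ eval.ker ≤ sector :=
  completeModGammaSector_iff_sectorForm.trans sectorForm_iff_ker_le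

/-! ## §3 Load-bearing hypotheses -/

/-- **Value equality is load-bearing**: `[pt, 1]` and `[pt, 2]` have KZ's literal shape and
`[pt,1] − [pt,2] ∉ sector` since the sector evaluates to `0` and `1 − 2 ≠ 0`. [folklore] -/
theorem completeModGammaSector_false_without_valueEq :
    ¬ (∀ ⦃n m : ℕ⦄ (r : IntegralRep n) (r' : IntegralRep m),
        r.IsRational → r'.IsRational → of r - of r' ∈ sector) := by
  intro h
  have h0 := eval_eq_zero_of_mem_sector
    (h (constRep 1) (constRep 2) (constRep_isRational 1) (constRep_isRational 2))
  rw [eval_of_sub_of, constRep_value, constRep_value] at h0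
  norm_num at h0

/-- **The rational shape is NOT load-bearing**: the crux is equivalent to its version for ALL
(`ℚ`-semialgebraic) integral representations (KZ §1.1: algebraic integrands reduce to rational
ones by one graph move; tree: `KZ.exists_isRational_equivalent_holds`).
[cite: KontsevichZagier2001, §1.1 remark after the Definition] -/
theorem sectorForm_iff_withoutRational :
    SectorForm ↔
      ∀ ⦃n m : ℕ⦄ (r : IntegralRep n) (r' : IntegralRep m), r.value = r'.value → of r - of r' ∈ sector :=
  ⟨fun h _ _ r r' hv => sectorForm_iff_ker_le.mp h
      (show eval (of r - of r') = 0 by rw [eval_of_sub_of, hv, sub_self]),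
    fun h _ _ r r' _ _ hv => h r r' hv⟩

/-- … and for the live crux. [folklore] -/
theorem completeModGammaSector_iff_withoutRational :
    CompleteModGammaSector ↔
      ∀ ⦃n m : ℕ⦄ (r : IntegralRep n) (r' : IntegralRep m), r.value = r'.value → of r - of r' ∈ sector :=
  completeModGammaSector_iff_sectorForm.trans sectorForm_iff_withoutRational

end Summit.KontsevichZagierPeriods.CompleteModGammaSectorNegative
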